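import Mathlib

/-!
# Real arithmetic of the truncated-dodger kill (negative side of `KolmogorovFloorEnsembleCeiling`,
# stmt-AnomalousDissipation-14183; also `KolmogorovFloor`, stmt-14030)

Line lead `prover-line-stmt-AnomalousDissipation-14183-0` (2026-08-16). Pure real-number lemmas used by
`Negative/Dodger.lean`, written in the cube-root variables `x = (C/N')^{1/3}`, `y = N'^{1/3}` (so that the
matched Kolmogorov viscosity is `ν = x⁴`, `N' = y³`, `C = (xy)³`, `N'^{4/3} = y⁴`, `N'^{8/3} = y⁸` and every
quantity is polynomial):

* `cubeRoot_bookkeeping` — the dictionary between `C, N', ν` and `x, y` (the only place with real powers);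
* `dodger_ball` — the two test states `a ± tŵ` (`t² = 51ν√‖∇a‖² + ν²`) fit in the Leray ball `16‖f‖²/ν²`;
* `dodger_endgame` — the sign-averaged floor `2ε₀ ≤ (4B+1)ν‖∇a‖² + 4Bνt²·4π²K₁²N'²` is absurd once
  `‖∇a‖² ≤ δ N'^{4/3}` with `δ` small and `N'` large.
-/

noncomputable section

namespace Summit.AnomalousDissipation.AnomalousDissipation.Theorems.KolmogorovFloorEnsembleCeiling.Negative

/-- **Cube-root bookkeeping.** For `C > 0` and a level `n ≥ max(1, C)` put `x = (C/n)^{1/3}`, `y = n^{1/3}`: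
then `x, y > 0`, `x ≤ 1 ≤ y`, `x³ = C/n`, `y³ = n`, `(xy)³ = C`, the matched viscosity `ν = (C/n)^{4/3}`
equals `x⁴` and satisfies `C ν^{-3/4} = n`, and `n^{4/3} = y⁴`, `n^{8/3} = y⁸`. -/
theorem cubeRoot_bookkeeping {C n : ℝ} (hC : 0 < C) (hn1 : 1 ≤ n) (hnC : C ≤ n) :
    let x : ℝ := (C / n) ^ (1 / 3 : ℝ)
    let y : ℝ := n ^ (1 / 3 : ℝ)
    0 < x ∧ 0 < y ∧ x ≤ 1 ∧ 1 ≤ y ∧ x ^ 3 = C / n ∧ y ^ 3 = n ∧ (x * y) ^ 3 = C ∧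
      (C / n) ^ (4 / 3 : ℝ) = x ^ 4 ∧ C * ((C / n) ^ (4 / 3 : ℝ)) ^ (-(3 / 4 : ℝ)) = n ∧
        n ^ (4 / 3 : ℝ) = y ^ 4 ∧ n ^ (8 / 3 : ℝ) = y ^ 8 := by
  intro x y
  have hn : 0 < n := by linarith
  have hq : 0 < C / n := div_pos hC hn
  have hq1 : C / n ≤ 1 := (div_le_one hn).2 hnC
  have hx : 0 < x := Real.rpow_pos_of_pos hq _
  have hy : 0 < y := Real.rpow_pos_of_pos hn _
  have hx3 : x ^ 3 = C / n := by
    show ((C / n) ^ (1 / 3 : ℝ)) ^ 3 = C / n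
    rw [← Real.rpow_natCast, ← Real.rpow_mul hq.le]
    norm_num
  have hy3 : y ^ 3 = n := by
    show (n ^ (1 / 3 : ℝ)) ^ 3 = n
    rw [← Real.rpow_natCast, ← Real.rpow_mul hn.le]
    norm_num
  have hx1 : x ≤ 1 := by
    show (C / n) ^ (1 / 3 : ℝ) ≤ 1
    exact Real.rpow_le_one hq.le hq1 (by norm_num)
  have hy1 : 1 ≤ y := by
    show 1 ≤ n ^ (1 / 3 : ℝ)
    exact Real.one_le_rpow hn1 (by norm_num)
  have hxy : (x * y) ^ 3 = C := by
    rw [mul_pow, hx3, hy3]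
    field_simp
  have hν : (C / n) ^ (4 / 3 : ℝ) = x ^ 4 := by
    show (C / n) ^ (4 / 3 : ℝ) = ((C / n) ^ (1 / 3 : ℝ)) ^ 4
    rw [← Real.rpow_natCast, ← Real.rpow_mul hq.le]
    norm_num
  have hνinv : C * ((C / n) ^ (4 / 3 : ℝ)) ^ (-(3 / 4 : ℝ)) = n := by
    rw [← Real.rpow_mul hq.le]
    norm_num
    rw [Real.rpow_neg_one, inv_div]
    field_simp
  have hn43 : n ^ (4 / 3 : ℝ) = y ^ 4 := by
    show n ^ (4 / 3 : ℝ) = (n ^ (1 / 3 : ℝ)) ^ 4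
    rw [← Real.rpow_natCast, ← Real.rpow_mul hn.le]
    norm_num
  have hn83 : n ^ (8 / 3 : ℝ) = y ^ 8 := by
    show n ^ (8 / 3 : ℝ) = (n ^ (1 / 3 : ℝ)) ^ 8
    rw [← Real.rpow_natCast, ← Real.rpow_mul hn.le]
    norm_num
  exact ⟨hx, hy, hx1, hy1, hx3, hy3, hxy, hν, hνinv, hn43, hn83⟩

/-- **The Leray ball.** With `x ≤ 1 ≤ y`, energy `E₀ ≤ δ y⁸`, enstrophy `Eₐ ≤ δ y⁴`, the packet energy
`τ = 51 x⁴ √Eₐ + x⁸`, and the smallness conditions `δ (xy)⁸ ≤ 4F`, `(102 √δ + 2) (xy)¹² ≤ 8F·y³`,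
both test states fit in the ball: `2E₀ + 2τ ≤ 16 F / (x⁴)²`. -/
theorem dodger_ball {x y δ F E₀ Ea : ℝ} (hx : 0 < x) (hx1 : x ≤ 1) (hy1 : 1 ≤ y) (hδ : 0 ≤ δ) (hF : 0 ≤ F)
    (hE₀ : E₀ ≤ δ * y ^ 8) (hEa : Ea ≤ δ * y ^ 4)
    (hδF : δ * (x * y) ^ 8 ≤ 4 * F) (hnF : (102 * Real.sqrt δ + 2) * (x * y) ^ 12 ≤ 8 * F * y ^ 3) :
    2 * E₀ + 2 * (51 * x ^ 4 * Real.sqrt Ea + x ^ 8) ≤ 16 * F / (x ^ 4) ^ 2 := by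
  have hy : 0 < y := by linarith
  have hx8 : 0 < (x ^ 4) ^ 2 := by positivity
  rw [le_div_iff₀ hx8]
  have hsq : Real.sqrt Ea ≤ Real.sqrt δ * y ^ 2 := by
    calc Real.sqrt Ea ≤ Real.sqrt (δ * y ^ 4) := Real.sqrt_le_sqrt hEa
      _ = Real.sqrt δ * y ^ 2 := by
          rw [Real.sqrt_mul hδ, show y ^ 4 = (y ^ 2) ^ 2 by ring, Real.sqrt_sq (by positivity)]
  have hsd : 0 ≤ Real.sqrt δ := Real.sqrt_nonneg _
  -- `x¹²y² ≤ x¹²y³`, `x¹⁶ ≤ x¹² ≤ x¹² y³`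
  have hy23 : y ^ 2 ≤ y ^ 3 := by nlinarith
  have hx1612 : x ^ 16 ≤ x ^ 12 := by
    have : x ^ 16 = x ^ 12 * x ^ 4 := by ring
    rw [this]
    have hx4 : x ^ 4 ≤ 1 := pow_le_one₀ hx.le hx1
    nlinarith [pow_pos hx 12]
  have hxy12 : x ^ 12 ≤ x ^ 12 * y ^ 3 := by
    have : 1 ≤ y ^ 3 := one_le_pow₀ hy1
    nlinarith [pow_pos hx 12]
  -- main estimate
  have h1 : 2 * E₀ * (x ^ 4) ^ 2 ≤ 2 * δ * (x * y) ^ 8 := by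
    have : (x * y) ^ 8 = y ^ 8 * (x ^ 4) ^ 2 := by ring
    rw [this]
    nlinarith [hE₀, pow_pos hx 8]
  have h2 : 2 * (51 * x ^ 4 * Real.sqrt Ea + x ^ 8) * (x ^ 4) ^ 2 ≤ (102 * Real.sqrt δ + 2) * (x ^ 12 * y ^ 3) := by
    have e : 2 * (51 * x ^ 4 * Real.sqrt Ea + x ^ 8) * (x ^ 4) ^ 2 = 102 * x ^ 12 * Real.sqrt Ea + 2 * x ^ 16 := by ring
    rw [e]
    have h21 : 102 * x ^ 12 * Real.sqrt Ea ≤ 102 * x ^ 12 * (Real.sqrt δ * y ^ 3) := by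
      have : Real.sqrt Ea ≤ Real.sqrt δ * y ^ 3 := le_trans hsq (by nlinarith)
      nlinarith [pow_pos hx 12]
    nlinarith [h21, hx1612, hxy12, hsd, pow_pos hx 12, pow_pos hy 3]
  have h3 : (102 * Real.sqrt δ + 2) * (x ^ 12 * y ^ 3) ≤ 8 * F := by
    have e : (x * y) ^ 12 = x ^ 12 * y ^ 3 * y ^ 9 := by ring
    rw [e] at hnF
    have hy9 : 0 < y ^ 9 := by positivity
    have hy93 : 8 * F * y ^ 3 ≤ 8 * F * y ^ 9 := by
      have : y ^ 3 ≤ y ^ 9 := pow_le_pow_right₀ hy1 (by norm_num)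
      nlinarith
    have h' : (102 * Real.sqrt δ + 2) * (x ^ 12 * y ^ 3) * y ^ 9 ≤ 8 * F * y ^ 9 := by nlinarith
    exact le_of_mul_le_mul_right h' hy9
  nlinarith [h1, h2, h3, hδF]

/-- **Endgame.** The sign-averaged floor inequality
`2ε₀ ≤ (4B+1)·ν·Eₐ + 4B·ν·τ·(4π²K²n²)`, `ν = x⁴`, `n = y³`, `τ = 51ν√Eₐ + ν²`, `Eₐ ≤ δ y⁴`,
is absurd under the smallness conditions on `δ` (terms in `δ` and `√δ`) and the largeness of the level
(term in `x¹²y⁶ = C⁴/n²`). -/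
theorem dodger_endgame {ε₀ B K x y δ Ea : ℝ} (hε₀ : 0 < ε₀) (hB : 1 ≤ B) (hx : 0 < x)
    (hy1 : 1 ≤ y) (hδ : 0 ≤ δ) (hEa : Ea ≤ δ * y ^ 4)
    (hδ1 : (4 * B + 1) * (x * y) ^ 4 * δ ≤ ε₀ / 2)
    (hδ2 : 16 * Real.pi ^ 2 * B * K ^ 2 * 51 * (x * y) ^ 8 * Real.sqrt δ ≤ ε₀ / 2)
    (hn : 16 * Real.pi ^ 2 * B * K ^ 2 * (x ^ 12 * y ^ 6) ≤ ε₀ / 2)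
    (hmain : 2 * ε₀ ≤ (4 * B + 1) * (x ^ 4 * Ea) +
      4 * B * x ^ 4 * (51 * x ^ 4 * Real.sqrt Ea + x ^ 8) * (4 * Real.pi ^ 2 * K ^ 2 * (y ^ 3) ^ 2)) : False := by
  have hy : 0 < y := by linarith
  have hsq : Real.sqrt Ea ≤ Real.sqrt δ * y ^ 2 := by
    calc Real.sqrt Ea ≤ Real.sqrt (δ * y ^ 4) := Real.sqrt_le_sqrt hEa
      _ = Real.sqrt δ * y ^ 2 := by
          rw [Real.sqrt_mul hδ, show y ^ 4 = (y ^ 2) ^ 2 by ring, Real.sqrt_sq (by positivity)]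
  have hB0 : 0 < B := by linarith
  have hpi : 0 < Real.pi ^ 2 := by positivity
  -- term 1
  have h1 : (4 * B + 1) * (x ^ 4 * Ea) ≤ (4 * B + 1) * (x * y) ^ 4 * δ := by
    have : x ^ 4 * Ea ≤ x ^ 4 * (δ * y ^ 4) := by nlinarith [pow_pos hx 4]
    have e : (4 * B + 1) * (x * y) ^ 4 * δ = (4 * B + 1) * (x ^ 4 * (δ * y ^ 4)) := by ring
    rw [e]
    nlinarith
  -- term 2
  have h2 : 4 * B * x ^ 4 * (51 * x ^ 4 * Real.sqrt Ea + x ^ 8) * (4 * Real.pi ^ 2 * K ^ 2 * (y ^ 3) ^ 2) ≤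
      16 * Real.pi ^ 2 * B * K ^ 2 * 51 * (x * y) ^ 8 * Real.sqrt δ + 16 * Real.pi ^ 2 * B * K ^ 2 * (x ^ 12 * y ^ 6) := by
    have e : 4 * B * x ^ 4 * (51 * x ^ 4 * Real.sqrt Ea + x ^ 8) * (4 * Real.pi ^ 2 * K ^ 2 * (y ^ 3) ^ 2) =
        16 * Real.pi ^ 2 * B * K ^ 2 * 51 * (x ^ 8 * y ^ 6 * Real.sqrt Ea) + 16 * Real.pi ^ 2 * B * K ^ 2 * (x ^ 12 * y ^ 6) := by
      ring
    rw [e]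
    have hc : 0 ≤ 16 * Real.pi ^ 2 * B * K ^ 2 * 51 := by positivity
    have hin : x ^ 8 * y ^ 6 * Real.sqrt Ea ≤ (x * y) ^ 8 * Real.sqrt δ := by
      have e2 : (x * y) ^ 8 * Real.sqrt δ = x ^ 8 * y ^ 6 * (Real.sqrt δ * y ^ 2) := by ring
      rw [e2]
      exact mul_le_mul_of_nonneg_left hsq (by positivity)
    nlinarith [mul_le_mul_of_nonneg_left hin hc]
  linarith

end Summit.AnomalousDissipation.AnomalousDissipation.Theorems.KolmogorovFloorEnsembleCeiling.Negative
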